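import Summits.ABC.StewartYu.GenThreeInductionOdd
import HarnessLib

/-!
# Cell abc-stewartyu, Gen-3 frame at odd `p` (crux `Y07Odd`, stmt-ABC-19658): the frozen engine text
# `GenThreeEngineOdd` from the internal induction statement — Kummer dictionary and the floor rescaling

`Summits/ABC/StewartYu/GenThreeInductionOddEngine.lean` — cell `abc-stewartyu` (HOME
`run/shared/lean/pub/abc-stewartyu/`), route `PadicPrimesKummerThird`, seat p4 (g3), engine-support seat;
sequel of `GenThreeInductionOdd.lean` (same namespace), odd-`p` twin of the last section of p3-g5's
`GenThreeInductionTwo.lean`.  Theorems only.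

* `kummerPM_of_not_isSquare` / `not_isSquare_of_kummerPM` — the frozen text's SUBSET form of the `2`-Kummer
  condition (`¬ IsSquare (±∏_{j∈T} αⱼ)` for nonempty `T`) ↔ the signed `ℤ`-divisibility form
  (`∏ αⱼ^{φⱼ} = ±γ² ⇒ 2 ∣ φⱼ`) of the internal statement `CoreOdd` (no independence needed either way; the
  second direction is the shape a CW77-style descent consumes at every induction level);
* `engineOdd_of_core` — the text `GenThreeEngineOdd` of the birth skeleton of `Y07Odd` (= the hypothesis of
  `Summit.ABC.StewartYu.YuOhSeven.y07Odd_of_genThreeEngineOdd`) VERBATIM from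
  `∀ p prime ≠ 2, ∀ r, CoreOdd C p r`: the floor `log 2 ≤ Vⱼ` of the text is lifted to the internal floor
  `1 ≤ Vⱼ / log 2` by the rescaling `V ↦ V / log 2`, absorbed as `C m ↦ C m · (2 / log 2)^m`,
  `c₁ ↦ 2c₁ / log 2` (`−log log 2 ≤ 1 ≤ W + log p + log 2Vmax`); `1 ≤ W` is read off `log max(3,|b₀|) ≤ W`;
* `engineOdd_of_dichotomy` — hence `stub_engineOdd` ⇐ `∀ p prime ≠ 2, ∀ n, DichotomyOdd C p n`.

WHAT THIS IS NOT: no analytic content; no crux moves.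

References: Yu. V. Nesterenko, LNM 1819 (2003), Thm 2.1, Prop. 2.6, Cor. 4.5; K. Yu, Forum Math. 19 (2007),
Main Theorem (`K = ℚ`).
-/

noncomputable section

open Finset

namespace Summit.ABC.StewartYu.GenThreeInductionOdd

/-! ### The Kummer condition: the frozen text's subset form ↔ the signed divisibility form -/

/-- **Subset form ⇒ signed divisibility form**: if no signed product `±∏_{j∈T} αⱼ` over a nonempty `T`
is a square, then `∏ αⱼ^{φⱼ} = ±γ² ⇒ 2 ∣ φⱼ` (reduce `φ` mod `2`). [folklore] -/
theorem kummerPM_of_not_isSquare {K : Type*} [Field K] {n : ℕ} (α : Fin n → K) (hα : ∀ j, α j ≠ 0)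
    (hT : ∀ T : Finset (Fin n), T.Nonempty → ¬ IsSquare (∏ j ∈ T, α j) ∧ ¬ IsSquare (-∏ j ∈ T, α j)) :
    ∀ φ : Fin n → ℤ, (∃ γ : K, ∏ j, α j ^ φ j = γ ^ 2 ∨ ∏ j, α j ^ φ j = -γ ^ 2) →
      ∀ j, (2 : ℤ) ∣ φ j := by
  classical
  intro φ hφ
  by_contra hnot
  push Not at hnot
  obtain ⟨j₀, hj₀⟩ := hnot
  obtain ⟨γ, hγ⟩ := hφ
  -- split `φ = 2ψ + ε`, `ε ∈ {0,1}`
  set T : Finset (Fin n) := Finset.univ.filter fun j => φ j % 2 = 1 with hTdef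
  set P : K := ∏ j, α j ^ (φ j / 2) with hPdef
  have hP0 : P ≠ 0 := Finset.prod_ne_zero_iff.mpr fun j _ => zpow_ne_zero _ (hα j)
  have hsplit : ∏ j, α j ^ φ j = P ^ 2 * ∏ j ∈ T, α j := by
    rw [hTdef, Finset.prod_filter, hPdef, ← Finset.prod_pow, ← Finset.prod_mul_distrib]
    refine Finset.prod_congr rfl fun j _ => ?_
    have hdecomp : φ j = φ j / 2 * 2 + φ j % 2 := by omega
    rcases Int.emod_two_eq_zero_or_one (φ j) with h0 | h1
    · rw [if_neg (by omega), mul_one]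
      conv_lhs => rw [hdecomp, h0, add_zero, zpow_mul]
      norm_cast
    · rw [if_pos h1]
      conv_lhs => rw [hdecomp, h1, zpow_add₀ (hα j), zpow_mul, zpow_one]
      norm_cast
  have hTne : T.Nonempty := by
    refine ⟨j₀, ?_⟩
    rw [hTdef, Finset.mem_filter]
    refine ⟨Finset.mem_univ _, ?_⟩
    rcases Int.emod_two_eq_zero_or_one (φ j₀) with h0 | h1
    · exact absurd (Int.dvd_of_emod_eq_zero h0) hj₀
    · exact h1
  obtain ⟨hsq, hsqneg⟩ := hT T hTne
  rcases hγ with h | h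
  · apply hsq
    refine ⟨γ / P, ?_⟩
    have : ∏ j ∈ T, α j = γ ^ 2 / P ^ 2 := by
      rw [eq_div_iff (pow_ne_zero 2 hP0), mul_comm, ← hsplit, h]
    rw [this]; field_simp
  · apply hsqneg
    refine ⟨γ / P, ?_⟩
    have : ∏ j ∈ T, α j = -γ ^ 2 / P ^ 2 := by
      rw [eq_div_iff (pow_ne_zero 2 hP0), mul_comm, ← hsplit, h]
    rw [this]; field_simp

/-- **Signed divisibility form ⇒ subset form** (the shape the descent à la CW77 consumes): if
`∏ αⱼ^{φⱼ} = ±γ² ⇒ 2 ∣ φⱼ`, then no signed product `±∏_{j∈T} αⱼ` over a nonempty `T` is a square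
(`φ` = indicator of `T`). [folklore] -/
theorem not_isSquare_of_kummerPM {K : Type*} [Field K] {n : ℕ} (α : Fin n → K)
    (hK : ∀ φ : Fin n → ℤ, (∃ γ : K, ∏ j, α j ^ φ j = γ ^ 2 ∨ ∏ j, α j ^ φ j = -γ ^ 2) →
      ∀ j, (2 : ℤ) ∣ φ j) :
    ∀ T : Finset (Fin n), T.Nonempty → ¬ IsSquare (∏ j ∈ T, α j) ∧ ¬ IsSquare (-∏ j ∈ T, α j) := by
  classical
  intro T hT
  set φ : Fin n → ℤ := fun j => if j ∈ T then 1 else 0 with hφdef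
  have hprod : ∏ j, α j ^ φ j = ∏ j ∈ T, α j := by
    rw [← Finset.prod_filter_mul_prod_filter_not Finset.univ (fun j => j ∈ T)]
    have h1 : ∏ j ∈ Finset.univ.filter (fun j => j ∈ T), α j ^ φ j = ∏ j ∈ T, α j := by
      have hf : Finset.univ.filter (fun j => j ∈ T) = T := by ext j; simp
      rw [hf]
      exact Finset.prod_congr rfl fun j hj => by rw [hφdef]; simp [hj]
    have h2 : ∏ j ∈ Finset.univ.filter (fun j => ¬ j ∈ T), α j ^ φ j = 1 :=
      Finset.prod_eq_one fun j hj => by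
        rw [Finset.mem_filter] at hj
        rw [hφdef]; simp [hj.2]
    rw [h1, h2, mul_one]
  obtain ⟨j₀, hj₀⟩ := hT
  have hodd : ¬ (2 : ℤ) ∣ φ j₀ := by rw [hφdef]; simp [hj₀]
  refine ⟨fun hsq => hodd (hK φ ?_ j₀), fun hsq => hodd (hK φ ?_ j₀)⟩
  · obtain ⟨γ, hγ⟩ := hsq
    exact ⟨γ, Or.inl (by rw [hprod, hγ, sq])⟩
  · obtain ⟨γ, hγ⟩ := hsq
    refine ⟨γ, Or.inr ?_⟩
    rw [hprod, sq, ← hγ, neg_neg]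

/-! ### The frozen engine text from the core -/

/-- `1 ≤ W` from `log max(3,|b j|) ≤ W` at any index (`log 3 > 1`). [folklore] -/
theorem one_le_of_log_max_three_le {x W : ℝ} (h : Real.log (max 3 x) ≤ W) : 1 ≤ W := by
  have h3 : Real.log 3 ≤ Real.log (max 3 x) :=
    Real.log_le_log (by norm_num) (le_max_left _ _)
  have h1 : (1 : ℝ) < Real.log 3 := by
    have := Real.exp_one_lt_d9
    rw [Real.lt_log_iff_exp_lt (by norm_num)]
    linarith
  linarith

/-- **The frozen crux-side engine text `GenThreeEngineOdd` from the internal statement**: the text of the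
birth skeleton of `Y07Odd` (= the hypothesis of `Summit.ABC.StewartYu.YuOhSeven.y07Odd_of_genThreeEngineOdd`)
follows from `∀ p prime ≠ 2, ∀ r, CoreOdd C p r`: the subset-form Kummer hypothesis is turned into the
signed divisibility form (`kummerPM_of_not_isSquare`), the floor `log 2 ≤ Vⱼ` is lifted to `1 ≤ Vⱼ/log 2` by
the rescaling `V ↦ V / log 2` (absorbed: `C m ↦ C m · (2/log 2)^m`, `c₁ ↦ 2c₁/log 2`), and `1 ≤ W` is read
off `log max(3,|b₀|) ≤ W`. [cite: Yu2007, Main Thm (K = ℚ); shape only] -/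
theorem engineOdd_of_core {C : ℕ → ℝ} {c₁ : ℝ} (hc₁ : 1 ≤ c₁) (hC : ∀ m, 0 ≤ C m ∧ C m ≤ c₁ ^ m)
    (hcore : ∀ p : ℕ, p.Prime → p ≠ 2 → ∀ r, CoreOdd C p r) :
    ∃ (C : ℕ → ℝ) (c₁ : ℝ), 1 ≤ c₁ ∧ (∀ m, 0 ≤ C m ∧ C m ≤ c₁ ^ m) ∧
      ∀ (p : ℕ), p.Prime → p ≠ 2 → ∀ (m : ℕ) (α : Fin m → ℚ) (b : Fin m → ℤ) (V : Fin m → ℝ)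
        (Vmax W : ℝ),
        (∀ j, α j ≠ 0 ∧ padicValRat p (α j) = 0) →
        (∀ μ : Fin m → ℤ, ∏ j, α j ^ μ j = 1 → μ = 0) →
        (∀ T : Finset (Fin m), T.Nonempty → ¬ IsSquare (∏ j ∈ T, α j) ∧ ¬ IsSquare (-∏ j ∈ T, α j)) →
        (∀ j, Height.logHeight₁ (α j) ≤ V j) → (∀ j, Real.log 2 ≤ V j) → (∀ j, V j ≤ Vmax) →
        b ≠ 0 → (∀ j, Real.log (max 3 (|b j| : ℝ)) ≤ W) →
        (padicValRat p (∏ j, α j ^ b j - 1) : ℝ) * Real.log p ≤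
          C m * ((p : ℝ) / Real.log p) * (∏ j, V j) * (W + Real.log p + Real.log (2 * Vmax)) := by
  -- numerics of `log 2`
  have hl2 : (1 : ℝ) / 2 < Real.log 2 := by
    have := Real.log_two_gt_d9; linarith
  have hl2' : Real.log 2 < 1 := by
    have := Real.log_two_lt_d9; linarith
  have hl2pos : 0 < Real.log 2 := by linarith
  set L : ℝ := 2 / Real.log 2 with hLdef
  have hL1 : 1 ≤ L := by
    rw [hLdef, le_div_iff₀ hl2pos]; linarith
  refine ⟨fun m => C m * L ^ m, c₁ * L, ?_, ?_, ?_⟩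
  · nlinarith
  · intro m
    refine ⟨mul_nonneg (hC m).1 (pow_nonneg (by linarith) _), ?_⟩
    rw [mul_pow]
    exact mul_le_mul_of_nonneg_right (hC m).2 (pow_nonneg (by linarith) _)
  intro p hp hp2 m α b V Vmax W hα hind hT hV hV2 hVmax hb hW
  -- `m = 0` is vacuous (`b ≠ 0` impossible)
  rcases Nat.eq_zero_or_pos m with hm0 | hmpos
  · subst hm0
    exact absurd (funext fun j => Fin.elim0 j) hb
  -- `1 ≤ W`
  have j0 : Fin m := ⟨0, hmpos⟩
  have hW1 : 1 ≤ W := one_le_of_log_max_three_le (hW j0)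
  -- rescaled weights
  set V' : Fin m → ℝ := fun j => V j / Real.log 2 with hV'def
  have hV'1 : ∀ j, 1 ≤ V' j := fun j => by
    rw [hV'def]; dsimp only; rw [le_div_iff₀ hl2pos, one_mul]; exact hV2 j
  have hVV' : ∀ j, V j ≤ V' j := fun j => by
    have hVj : 0 ≤ V j := hl2pos.le.trans (hV2 j)
    rw [hV'def]; dsimp only; rw [le_div_iff₀ hl2pos]
    nlinarith
  have hV' : ∀ j, Height.logHeight₁ (α j) ≤ V' j := fun j => (hV j).trans (hVV' j)
  have hV'max : ∀ j, V' j ≤ Vmax / Real.log 2 := fun j => by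
    rw [hV'def]; dsimp only; exact div_le_div_of_nonneg_right (hVmax j) hl2pos.le
  have hK := kummerPM_of_not_isSquare α (fun j => (hα j).1) hT
  have hmain := hcore p hp hp2 m α b V' (Vmax / Real.log 2) W hα hind hK hV' hV'1 hV'max hb hW hW1
  -- comparison of the right-hand sides
  have hprodV' : ∏ j, V' j = (∏ j, V j) / Real.log 2 ^ m := by
    rw [hV'def]
    simp only []
    rw [Finset.prod_div_distrib, Finset.prod_const, Finset.card_univ, Fintype.card_fin]
  have hVmax2 : Real.log 2 ≤ Vmax := (hV2 j0).trans (hVmax j0)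
  have hVmaxpos : 0 < Vmax := hl2pos.trans_le hVmax2
  have hlog2V : Real.log (2 * (Vmax / Real.log 2)) = Real.log (2 * Vmax) - Real.log (Real.log 2) := by
    rw [mul_div_assoc', Real.log_div (by positivity) hl2pos.ne']
  -- `S := W + log p + log 2Vmax ≥ 1`, and `- log log 2 ≤ log 2 ≤ 1 ≤ (L^m·(log 2)^m - 1)·S`-type room
  have hlogp : 0 ≤ Real.log p := Real.log_natCast_nonneg p
  have hlog2Vmax : 0 ≤ Real.log (2 * Vmax) := Real.log_nonneg (by linarith)
  have hS1 : 1 ≤ W + Real.log p + Real.log (2 * Vmax) := by linarith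
  have hll2 : -Real.log (Real.log 2) ≤ 1 := by
    -- `1/2 < log 2` ⇒ `log (log 2) > log (1/2) = -log 2 > -1`
    have h1 : Real.log (1 / 2) < Real.log (Real.log 2) := Real.log_lt_log (by norm_num) hl2
    rw [Real.log_div one_ne_zero two_ne_zero, Real.log_one, zero_sub] at h1
    linarith
  have hprodV0 : 0 ≤ ∏ j, V j := Finset.prod_nonneg fun j _ => hl2pos.le.trans (hV2 j)
  have hpl : 0 ≤ (p : ℝ) / Real.log p := div_log_nonneg p
  -- `L^m = 2^m / (log 2)^m` and `2^m ≥ 2`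
  have hLm : L ^ m * Real.log 2 ^ m = 2 ^ m := by
    rw [hLdef, div_pow, div_mul_cancel₀ _ (pow_ne_zero _ hl2pos.ne')]
  have h2m : (2 : ℝ) ≤ 2 ^ m := by
    calc (2 : ℝ) = 2 ^ 1 := by norm_num
      _ ≤ 2 ^ m := pow_le_pow_right₀ (by norm_num) hmpos
  -- the target
  calc (padicValRat p (∏ j, α j ^ b j - 1) : ℝ) * Real.log p
      ≤ C m * ((p : ℝ) / Real.log p) * (∏ j, V' j) *
          (W + Real.log p + Real.log (2 * (Vmax / Real.log 2))) := hmain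
    _ = C m * ((p : ℝ) / Real.log p) * ((∏ j, V j) / Real.log 2 ^ m) *
          (W + Real.log p + Real.log (2 * Vmax) - Real.log (Real.log 2)) := by
        rw [hprodV', hlog2V]; ring
    _ ≤ C m * ((p : ℝ) / Real.log p) * ((∏ j, V j) / Real.log 2 ^ m) *
          (2 ^ m * (W + Real.log p + Real.log (2 * Vmax))) := by
        have hfac : 0 ≤ C m * ((p : ℝ) / Real.log p) * ((∏ j, V j) / Real.log 2 ^ m) :=
          mul_nonneg (mul_nonneg (hC m).1 hpl) (div_nonneg hprodV0 (pow_nonneg hl2pos.le _))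
        refine mul_le_mul_of_nonneg_left ?_ hfac
        nlinarith
    _ = C m * L ^ m * ((p : ℝ) / Real.log p) * (∏ j, V j) * (W + Real.log p + Real.log (2 * Vmax)) := by
        rw [← hLm]
        field_simp

/-- **Reduction of the registered stub**: `stub_engineOdd : Nesterenko2003_prop51 → GenThreeEngineOdd` follows
from ONE admissible constant function `C ≤ c₁ⁿ` for which the zero estimate yields the per-rank dichotomy at
every rank and every odd prime. [cite: Nesterenko2003, Thm 2.1 from Prop 2.6] -/
theorem engineOdd_of_dichotomy {Z : Prop} {C : ℕ → ℝ} {c₁ : ℝ} (hc₁ : 1 ≤ c₁)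
    (hC : ∀ m, 0 ≤ C m ∧ C m ≤ c₁ ^ m)
    (hD : Z → ∀ p : ℕ, p.Prime → p ≠ 2 → ∀ n, DichotomyOdd C p n) (hZ : Z) :
    ∃ (C : ℕ → ℝ) (c₁ : ℝ), 1 ≤ c₁ ∧ (∀ m, 0 ≤ C m ∧ C m ≤ c₁ ^ m) ∧
      ∀ (p : ℕ), p.Prime → p ≠ 2 → ∀ (m : ℕ) (α : Fin m → ℚ) (b : Fin m → ℤ) (V : Fin m → ℝ)
        (Vmax W : ℝ),
        (∀ j, α j ≠ 0 ∧ padicValRat p (α j) = 0) →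
        (∀ μ : Fin m → ℤ, ∏ j, α j ^ μ j = 1 → μ = 0) →
        (∀ T : Finset (Fin m), T.Nonempty → ¬ IsSquare (∏ j ∈ T, α j) ∧ ¬ IsSquare (-∏ j ∈ T, α j)) →
        (∀ j, Height.logHeight₁ (α j) ≤ V j) → (∀ j, Real.log 2 ≤ V j) → (∀ j, V j ≤ Vmax) →
        b ≠ 0 → (∀ j, Real.log (max 3 (|b j| : ℝ)) ≤ W) →
        (padicValRat p (∏ j, α j ^ b j - 1) : ℝ) * Real.log p ≤
          C m * ((p : ℝ) / Real.log p) * (∏ j, V j) * (W + Real.log p + Real.log (2 * Vmax)) :=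
  engineOdd_of_core hc₁ hC fun p hp hp2 => core_of_dichotomy (hD hZ p hp hp2)

end Summit.ABC.StewartYu.GenThreeInductionOdd

end
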